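import Summits.QuantumFields.YangMills.Theorems.UniversalDetectorReflectedKernel
import Summits.QuantumFields.YangMills.Theorems.UniversalDetectorRPStep

/-!
# Route `UniversalDetector`, support item `PlaneLimitExtraction` (stmt-QuantumFields-23251) — the time-reflection
defect of the rescaled density kernel is `≤ Σ_{pq} |ω_{pq}(s)|` under (TIGHT6)

Ideator seat ym-idea-8 g7 (LINE 4 of rung R2a = `BalabanLadder.NT`).  The lattice kernel
`ker(z) = s⁻⁸ Cov_T(dens 0, dens z)` is exactly even and permutation invariant but NOT exactly invariant under
the site time reflection `ϑ` (temporal plaquettes of the reflected density hang one unit below the mirror site).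
`abs_cov_dens_sub_cov_dens_siteReflect_le` (`UniversalDetectorReflectedKernel`) bounds the defect by the one-step
time differences of the 36 plane-resolved kernels at `ϑz`, `ϑz ± e₀`; here these are bounded by the equicontinuity
moduli of (TIGHT6) at half the separation: for `z ∈ box 4 L` with `η ≤ ‖s z‖`, `2s ≤ η` and no time wrap
(`|z₀| + 1 ≤ L`),

  `|ker(z) - ker(ϑz)| ≤ Σ_{p<q valid} Σ |ω_{pq}(s)|`     (`reflect_defect_of_tight6`),

which tends to `0` along the route's sequences — the input for the clause `K(ϑz) = K(z)` of `PlaneLimitExtraction`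
(approximate invariances pass to the mesh limit).  No summit, rung or crux is proved here.
-/

set_option autoImplicit false

noncomputable section

open MeasureTheory Filter Topology
open Literature.MathematicalPhysics.QuantumFieldTheory Literature.MathematicalPhysics.QuantumLattice
  Literature.Probability.LatticeModels
open Summit.QuantumFields.YangMills.Cruxes.OSLegsFromFemtoAndGap.DlrCollarTransfer

namespace Summit.QuantumFields.YangMills.Cruxes.UniversalDetectorPlaneTight

variable {G : Type} [Group G] [TopologicalSpace G] [IsTopologicalGroup G] [CompactSpace G]
  [MeasurableSpace G] [BorelSpace G] (r : LatticeRep G)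

omit [Group G] [TopologicalSpace G] [IsTopologicalGroup G] [CompactSpace G] [MeasurableSpace G] [BorelSpace G] r in
/-- The site time reflection is an isometry in physical units: `‖s ϑz‖ = ‖s z‖`. -/
theorem norm_smul_siteToE_siteReflect (s : ℝ) (z : Site 4) :
    ‖s • siteToE (siteReflect z)‖ = ‖s • siteToE z‖ := by
  rw [← timeReflection_smul_siteToE, LinearIsometryEquiv.norm_map]

omit [Group G] [TopologicalSpace G] [IsTopologicalGroup G] [CompactSpace G] [MeasurableSpace G] [BorelSpace G] r in
/-- `‖s (-e₀)‖ = s` (`s ≥ 0`). -/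
theorem norm_smul_siteToE_neg_single {s : ℝ} (hs : 0 ≤ s) :
    ‖s • siteToE (-(Pi.single (0 : Fin 4) (1 : ℤ)) : Site 4)‖ = s := by
  have h : siteToE (-(Pi.single (0 : Fin 4) (1 : ℤ)) : Site 4) = -siteToE (Pi.single (0 : Fin 4) (1 : ℤ) : Site 4) := by
    ext i; simp [siteToE_apply]
  rw [h, smul_neg, norm_neg, norm_smul_siteToE_single hs]

omit [Group G] [TopologicalSpace G] [IsTopologicalGroup G] [CompactSpace G] [MeasurableSpace G] [BorelSpace G] r in
/-- No time wrap: `ϑz + v` stays in the box for a time shift `v ∈ {0, e₀, -e₀}` when `|z₀| + 1 ≤ L`. -/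
theorem siteReflect_add_mem_box {L : ℕ} {z : Site 4} (hz : z ∈ box 4 L) (hz0 : |z 0| + 1 ≤ (L : ℤ))
    (v : Site 4) (hv0 : |v 0| ≤ 1) (hv : ∀ i, i ≠ 0 → v i = 0) : siteReflect z + v ∈ box 4 L := by
  rw [mem_box] at hz ⊢
  intro i
  by_cases hi : i = 0
  · subst hi
    rw [Pi.add_apply, siteReflect_apply_zero]
    have h1 := abs_le.1 hv0
    have h2 := le_abs_self (z 0)
    have h3 := neg_abs_le (z 0)
    constructor <;> omega
  · rw [Pi.add_apply, siteReflect_apply_of_ne _ hi, hv i hi, add_zero]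
    exact hz i

/-- **Time-reflection defect of the rescaled density kernel under (TIGHT6).**  On the odd torus `2L+1` at one
coupling (`s = a(β) > 0`): if the 36 plane-resolved rescaled kernels satisfy the inner statement of (TIGHT6) at
separation `η/2` with bounds `C p q` and moduli `ω p q`, then for every `z ∈ box 4 L` with `η ≤ ‖s z‖`, `2s ≤ η` and
`|z₀| + 1 ≤ L`,
`|s⁻⁸ Cov_T(dens 0, dens z) − s⁻⁸ Cov_T(dens 0, dens ϑz)| ≤ Σ_{p} Σ_{q} |ω p q (s)|` (sums over the valid
orientations `p.1 < p.2`, `q.1 < q.2`). -/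
theorem reflect_defect_of_tight6 (β : ℝ) (L : ℕ) {s η : ℝ} (hs : 0 < s) (hsη : 2 * s ≤ η)
    (C : Fin 4 × Fin 4 → Fin 4 × Fin 4 → ℝ) (ω : Fin 4 × Fin 4 → Fin 4 × Fin 4 → ℝ → ℝ)
    (hT6 : ∀ p q : Fin 4 × Fin 4, p.1 < p.2 → q.1 < q.2 → ∀ z₁ ∈ box 4 L, η / 2 ≤ ‖s • siteToE z₁‖ →
      |s⁻¹ ^ 8 * (torusE G r β L (fun U => plane G r p 0 U * plane G r q z₁ U) -
          torusE G r β L (plane G r p 0) * torusE G r β L (plane G r q z₁))| ≤ C p q ∧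
        ∀ z₂ ∈ box 4 L, η / 2 ≤ ‖s • siteToE z₂‖ →
          |s⁻¹ ^ 8 * (torusE G r β L (fun U => plane G r p 0 U * plane G r q z₁ U) -
              torusE G r β L (plane G r p 0) * torusE G r β L (plane G r q z₁)) -
            s⁻¹ ^ 8 * (torusE G r β L (fun U => plane G r p 0 U * plane G r q z₂ U) -
              torusE G r β L (plane G r p 0) * torusE G r β L (plane G r q z₂))| ≤
            ω p q ‖s • siteToE z₁ - s • siteToE z₂‖)
    {z : Site 4} (hz : z ∈ box 4 L) (hz0 : |z 0| + 1 ≤ (L : ℤ)) (hzη : η ≤ ‖s • siteToE z‖) :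
    |s⁻¹ ^ 8 * (torusE G r β L (fun V => dens G r 0 V * dens G r z V) -
        torusE G r β L (dens G r 0) * torusE G r β L (dens G r z)) -
      s⁻¹ ^ 8 * (torusE G r β L (fun V => dens G r 0 V * dens G r (siteReflect z) V) -
        torusE G r β L (dens G r 0) * torusE G r β L (dens G r (siteReflect z)))| ≤
      ∑ p : {q : Fin 4 × Fin 4 // q.1 < q.2}, ∑ q : {q : Fin 4 × Fin 4 // q.1 < q.2}, |ω p.1 q.1 s| := by
  have hθ : siteReflect z ∈ box 4 L := siteReflect_mem_box hz
  have hnθ : η / 2 ≤ ‖s • siteToE (siteReflect z)‖ := by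
    rw [norm_smul_siteToE_siteReflect]; linarith [hs.le]
  -- one admissible unit time step at the reflected point costs at most `s⁸ |ω_pq(s)|`
  have key : ∀ p q : {q : Fin 4 × Fin 4 // q.1 < q.2}, ∀ v : Site 4, ‖s • siteToE v‖ = s →
      siteReflect z + v ∈ box 4 L →
      |(torusE G r β L (fun V => plane G r p.1 0 V * plane G r q.1 (siteReflect z + v) V) -
          torusE G r β L (plane G r p.1 0) * torusE G r β L (plane G r q.1 (siteReflect z + v))) -
        (torusE G r β L (fun V => plane G r p.1 0 V * plane G r q.1 (siteReflect z) V) -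
          torusE G r β L (plane G r p.1 0) * torusE G r β L (plane G r q.1 (siteReflect z)))| ≤
        s ^ 8 * |ω p.1 q.1 s| := by
    intro p q v hvn hw
    have hsv : s • siteToE (siteReflect z + v) = s • siteToE (siteReflect z) + s • siteToE v := by
      rw [← smul_add]; congr 1; ext i; simp [siteToE_apply]
    have hnw : η / 2 ≤ ‖s • siteToE (siteReflect z + v)‖ := by
      rw [hsv]
      have h := norm_sub_norm_le (s • siteToE (siteReflect z)) (-(s • siteToE v))
      rw [sub_neg_eq_add, norm_neg, hvn, norm_smul_siteToE_siteReflect] at h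
      linarith
    have hdist : ‖s • siteToE (siteReflect z + v) - s • siteToE (siteReflect z)‖ = s := by
      rw [hsv, add_sub_cancel_left, hvn]
    have hk := (hT6 p.1 q.1 p.2 q.2 (siteReflect z + v) hw hnw).2 (siteReflect z) hθ hnθ
    rw [hdist] at hk
    rw [abs_sub_eq_pow_mul_abs_sub_scaled hs.ne']
    exact mul_le_mul_of_nonneg_left (hk.trans (le_abs_self _)) (by positivity)
  -- the plane-kernel differences of `abs_cov_dens_sub_cov_dens_siteReflect_le` are such steps (or vanish)
  have hb := abs_cov_dens_sub_cov_dens_siteReflect_le r β L z (fun p q => s ^ 8 * |ω p.1 q.1 s|) (by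
    intro p q
    by_cases hp : p.1.1 = 0 <;> by_cases hq : q.1.1 = 0 <;> simp only [hp, hq, if_true, if_false]
    · rw [sub_self, add_zero, sub_self, abs_zero]; positivity
    · rw [sub_zero]
      exact key p q _ (norm_smul_siteToE_single hs.le)
        (siteReflect_add_mem_box hz hz0 _ (by simp) (fun i hi => by simp [Pi.single_eq_of_ne hi]))
    · rw [zero_sub]
      exact key p q _ (norm_smul_siteToE_neg_single hs.le)
        (siteReflect_add_mem_box hz hz0 _ (by simp) (fun i hi => by simp [Pi.single_eq_of_ne hi]))
    · rw [sub_self, add_zero, sub_self, abs_zero]; positivity)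
  -- unscale
  rw [← mul_sub, abs_mul, abs_of_pos (by positivity : (0 : ℝ) < s⁻¹ ^ 8)]
  calc s⁻¹ ^ 8 * |(torusE G r β L (fun V => dens G r 0 V * dens G r z V) -
          torusE G r β L (dens G r 0) * torusE G r β L (dens G r z)) -
        (torusE G r β L (fun V => dens G r 0 V * dens G r (siteReflect z) V) -
          torusE G r β L (dens G r 0) * torusE G r β L (dens G r (siteReflect z)))|
      ≤ s⁻¹ ^ 8 * ∑ p : {q : Fin 4 × Fin 4 // q.1 < q.2}, ∑ q : {q : Fin 4 × Fin 4 // q.1 < q.2},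
          s ^ 8 * |ω p.1 q.1 s| := mul_le_mul_of_nonneg_left hb (by positivity)
    _ = ∑ p : {q : Fin 4 × Fin 4 // q.1 < q.2}, ∑ q : {q : Fin 4 × Fin 4 // q.1 < q.2}, |ω p.1 q.1 s| := by
        rw [Finset.mul_sum]
        refine Finset.sum_congr rfl fun p _ => ?_
        rw [Finset.mul_sum]
        refine Finset.sum_congr rfl fun q _ => ?_
        rw [← mul_assoc, ← mul_pow, inv_mul_cancel₀ hs.ne', one_pow, one_mul]

end Summit.QuantumFields.YangMills.Cruxes.UniversalDetectorPlaneTight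

end
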